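import Literature.NumberTheory.EllipticCurves.TateFormReduction
import Literature.NumberTheory.EllipticCurves.KernelReductionOrdinaryTorsionProofs
import HarnessLib

/-!
# Torsion of `ℓ`-power order on a Tate form of residue characteristic `ℓ`: the decomposition
# group moves it into the kernel of reduction

`Proofs` file (theorems only, no definitions, no named facts), topic `NumberTheory/EllipticCurves`.
The multiplicative counterpart of `KernelReductionInertiaProofs` (good reduction: inertia moves
every point into `E₁`, Silverman *AEC* VII.2.1).

Let `(L, w)` be a valued field whose residue field has characteristic `ℓ` (`w ℓ < 1`), `ℓ` odd,
and `T = W_L` a Weierstrass equation over `L` in **Tate form** (`TateFormLevels.IsTateForm`: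
`y² + xy = x³ + a₄x + a₆`, `|a₄| ≤ |a₆| < 1`, `a₆ ≠ 0` — the shape of a split multiplicative
equation, reducing to the node `y² + xy = x³`).  Then for **every** automorphism `σ` of `L/F`
preserving `w` (an isometry — no inertia hypothesis) and every point `P ∈ T(L)` of `ℓ`-power
order, the point `P^σ - P`, if affine, lies in the kernel of reduction `E₁` (`|x| > 1`):

* `TateForm.reducesToZero_of_hasNonsingularReduction_of_zsmul_eq_zero` — a point of `E₀(L)`
  killed by `ℓᵐ` lies in `E₁(L) ∪ {O}`: its image under `E₀(L) → κˣ` (`TateForm.toUnits`,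
  kernel `E₁`, *AEC* VII.2.1 and III.2.5) is an `ℓᵐ`-th root of unity of a field of
  characteristic `ℓ`, i.e. `1`;
* `TateForm.one_lt_valuation_of_map_sub_eq_some_of_zsmul_eq_zero` — the statement above.  For
  `P ∈ E₁` this is the integrality argument of `KernelReductionInertiaProofs`; a point of
  `E₀ ∖ E₁` of `ℓ`-power order does not exist (previous item); and a *small* point (`|x| < 1`,
  outside `E₀`) of odd order is not "middle" (`TateForm.lt_sq_of_mem`), so lies on one of the two
  branches `|y| < |x|`, `|y + x| < |x|` (`TateForm.branch`), as does `P^σ` with the same level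
  `|σx| = |x|` and the same branch; two such points differ by an element of `E₀`
  (`TateForm.not_isSmall_sub_of_branch₀/₁`, Silverman *ATAEC* V.4, Lemma 4.1.2 / Cor. IV.9.2(d)),
  which is again of `ℓ`-power order, hence in `E₁ ∪ {O}`.

On the Tate curve `E_q` this is the observation that `Γ_{K_v}` acts on
`E_q[ℓᵐ] = ⟨ζ_{ℓᵐ}, q^{1/ℓᵐ}⟩ / …` through `q^{1/ℓᵐ} ↦ ζ q^{1/ℓᵐ}`, `ζ ∈ μ_{ℓᵐ} ⊂ Ê_q(𝔪)`
(Serre 1968, IV, A.1.2–A.1.3: at a place of multiplicative reduction the Tate module is an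
extension of `ℤ_ℓ` by `ℤ_ℓ(1)`).  With the kernel-of-reduction count of
`KernelReductionOrdinaryTorsionProofs` (the Hasse invariant of a Tate form is a unit,
`HasseCoeffTateNormalFormProofs`) it bounds `#((σ - 1) T[ℓᵐ]) ≤ ℓᵐ`.

## References

* [SerreAbelianLadic1968] J.-P. Serre, *Abelian ℓ-adic representations and elliptic curves*
  (1968), Ch. IV, A.1.2–A.1.3.
* [SilvermanAEC2009] J. H. Silverman, *The Arithmetic of Elliptic Curves*, 2nd ed., VII.2.1,
  III.2.5, VII.3.1.
* [SilvermanATAEC1994] J. H. Silverman, *Advanced Topics*, V.4, Lemmas 4.1.1–4.1.4, Cor. IV.9.2(d).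
-/

noncomputable section

open scoped Classical NNReal

universe u

namespace Literature.NumberTheory.EllipticCurves

namespace TateForm

-- `_root_`: the import closure declares `Literature.NumberTheory.EllipticCurves.WeierstrassCurve.*`
open _root_.WeierstrassCurve

variable {L : Type u} [Field L] {w : Valuation L ℝ≥0}

/-- In a field of characteristic `ℓ`, a unit with `u ^ ℓᵐ = 1` is `1`. [folklore] -/
theorem units_eq_one_of_pow_prime_pow_eq_one {k : Type*} [Field k] {ℓ : ℕ} [hℓ : Fact ℓ.Prime]
    [CharP k ℓ] {m : ℕ} {u : kˣ} (hu : u ^ ℓ ^ m = 1) : u = 1 := by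
  ext
  have h : ((u : k) - 1) ^ ℓ ^ m = 0 := by
    rw [sub_pow_char_pow, one_pow, ← Units.val_pow_eq_pow_val, hu, Units.val_one, sub_self]
  exact sub_eq_zero.mp (pow_eq_zero_iff (pow_ne_zero m hℓ.out.ne_zero) |>.mp h)

/-- **`E₀`-points of `ℓ`-power order lie in `E₁ ∪ {O}`** on a Tate form of residue characteristic
`ℓ`: for `M/𝒪_w` with `M_L` in Tate form, `w ℓ < 1`, and `P ∈ E₀(L)` with `ℓᵐ • P = O`, `P`
reduces to `Õ` — its image under `toUnits : E₀(L) → κˣ` is an `ℓᵐ`-th root of unity in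
characteristic `ℓ`. [cite: SilvermanAEC2009, Prop. VII.2.1 and III.2.5(a)] -/
theorem reducesToZero_of_hasNonsingularReduction_of_zsmul_eq_zero {M : WeierstrassCurve w.integer}
    (hT : IsTateForm w (M.baseChange L)) {ℓ : ℕ} [hℓ : Fact ℓ.Prime] (hℓw : w ℓ < 1) {m : ℕ}
    {P : (M.baseChange L).toAffine.Point} (hP₀ : M.HasNonsingularReduction P)
    (hP : ((ℓ ^ m : ℕ) : ℤ) • P = 0) : M.ReducesToZero P := by
  haveI := charP_residueField_of_valuation_natCast_lt_one w hℓw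
  set P₀ : M.nonsingularReductionSubgroup (Valuation.integer.integers w) := ⟨P, hP₀⟩
  have h0 : (ℓ ^ m) • P₀ = 0 := Subtype.ext (by
    change (ℓ ^ m) • P = 0
    rw [← natCast_zsmul]
    exact hP)
  have hu : (Additive.toMul (toUnits hT P₀)) ^ ℓ ^ m = 1 := by
    rw [← toMul_nsmul, ← map_nsmul, h0, map_zero, toMul_zero]
  have h1 : toUnits hT P₀ = 0 := by
    have := units_eq_one_of_pow_prime_pow_eq_one hu
    rwa [← toMul_zero, Additive.toMul.injective.eq_iff] at this
  exact (toUnits_eq_zero_iff hT P₀).mp h1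

/-- An affine point `(x, y)` with `w x ≤ 1` of `ℓ`-power order on a Tate form of residue
characteristic `ℓ` is small (`w x < 1`): otherwise it would lie in `E₀ ∖ E₁`.
[cite: SilvermanAEC2009, Prop. VII.2.1] -/
theorem valuation_lt_one_of_zsmul_eq_zero {M : WeierstrassCurve w.integer}
    (hT : IsTateForm w (M.baseChange L)) {ℓ : ℕ} [hℓ : Fact ℓ.Prime] (hℓw : w ℓ < 1) {m : ℕ}
    {x y : L} {hxy : (M.baseChange L).toAffine.Nonsingular x y}
    (hP : ((ℓ ^ m : ℕ) : ℤ) • Affine.Point.some x y hxy = 0) (hx : w x ≤ 1) : w x < 1 := by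
  by_contra hx1
  have hns : M.HasNonsingularReduction (Affine.Point.some x y hxy) := by
    have := (isSmall_iff_not_hasNonsingularReduction hT (Affine.Point.some x y hxy)).not.mp hx1
    rwa [not_not] at this
  have hred := reducesToZero_of_hasNonsingularReduction_of_zsmul_eq_zero hT hℓw hns hP
  rw [WeierstrassCurve.reducesToZero_some_iff, not_mem_range_iff (Valuation.integer.integers w)]
    at hred
  exact absurd hx (not_le.mpr hred)

/-- **On a Tate form of residue characteristic `ℓ` (odd), every isometry moves the points of
`ℓ`-power order into the kernel of reduction.**  Let `W/F` be a Weierstrass equation with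
`W_L` in Tate form for `w` (`a₆ ≠ 0`), `w ℓ < 1`, `ℓ` an odd prime, `σ ∈ Aut(L/F)` with
`w ∘ σ = w`, and `P ∈ W(L)` with `ℓᵐ • P = O`.  If `P^σ - P = (s, t)` is affine then `w s > 1`.
See the module docstring. [cite: SilvermanATAEC1994, V.4 Lemma 4.1.2 and Cor. IV.9.2(d)]
[cite: SerreAbelianLadic1968, IV A.1.2] -/
theorem one_lt_valuation_of_map_sub_eq_some_of_zsmul_eq_zero {F : Type*} [Field F] [Algebra F L]
    (W : WeierstrassCurve F) [hint : (W.baseChange L).IsIntegral w.integer]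
    (hT : IsTateForm w (W.baseChange L)) (ha₆ : (W.baseChange L).a₆ ≠ 0)
    {ℓ : ℕ} [hℓ : Fact ℓ.Prime] (hℓ2 : ℓ ≠ 2) (hℓw : w ℓ < 1)
    (σ : L ≃ₐ[F] L) (hσ : ∀ z, w (σ z) = w z) {m : ℕ}
    (P : (W.baseChange L).toAffine.Point) (hPm : ((ℓ ^ m : ℕ) : ℤ) • P = 0)
    {s t : L} {hst : (W.baseChange L).toAffine.Nonsingular s t}
    (hE : Affine.Point.map (σ : L →ₐ[F] L) P - P = .some s t hst) : 1 < w s := by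
  obtain ⟨M, hM⟩ := hint.integral
  have hT' : IsTateForm w (M.baseChange L) := hM ▸ hT
  -- transport to the `𝒪_w`-model `M`
  set e := Affine.Point.congrEquiv hM with he
  have hodd : Odd (ℓ ^ m) := (hℓ.out.eq_two_or_odd'.resolve_left hℓ2).pow
  rcases P with _ | ⟨x, y, hxy⟩
  · exfalso
    rw [← Affine.Point.zero_def, map_zero, sub_zero] at hE
    exact Affine.Point.some_ne_zero _ hE.symm
  set σ' : L →ₐ[F] L := (σ : L →ₐ[F] L)
  have hσ₁ : ∀ z, w (σ' z) = w z := hσ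
  obtain ⟨hxy', hmap⟩ : ∃ h', Affine.Point.map σ' (.some x y hxy) = .some (σ' x) (σ' y) h' :=
    ⟨_, Affine.Point.map_some σ' hxy⟩
  rw [hmap] at hE
  -- `P^σ` and `T = P^σ - P` are `ℓᵐ`-torsion as well
  have hPσm : ((ℓ ^ m : ℕ) : ℤ) • Affine.Point.some (σ' x) (σ' y) hxy' = 0 := by
    rw [← hmap, ← map_zsmul, hPm, map_zero]
  have hTm : ((ℓ ^ m : ℕ) : ℤ) • Affine.Point.some s t hst = 0 := by
    rw [← hE, zsmul_sub, hPσm, hPm, sub_zero]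
  by_contra hs
  rw [not_lt] at hs
  -- `T` is small: `w s < 1` (a point of `E₀ ∖ E₁` of `ℓ`-power order does not exist)
  have hTm' : ((ℓ ^ m : ℕ) : ℤ) • e (Affine.Point.some s t hst) = 0 := by
    rw [← map_zsmul, hTm, map_zero]
  rw [he, Affine.Point.congrEquiv_some hM] at hTm'
  have hs1 : w s < 1 := valuation_lt_one_of_zsmul_eq_zero hT' hℓw hTm' hs
  have ht : w t ≤ 1 := val_y_le_one hst.1 hs
  by_cases hx : w x ≤ 1
  · -- `P` integral, hence small; not middle; on a branch shared with `P^σ`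
    have hPm' : ((ℓ ^ m : ℕ) : ℤ) • e (Affine.Point.some x y hxy) = 0 := by
      rw [← map_zsmul, hPm, map_zero]
    rw [he, Affine.Point.congrEquiv_some hM] at hPm'
    have hx1 : w x < 1 := valuation_lt_one_of_zsmul_eq_zero hT' hℓw hPm' hx
    -- not middle: `w a₆ < (w x)²`, from `lt_sq_of_mem` for the `ℓᵐ`-torsion subgroup
    have hmid : w (W.baseChange L).a₆ < w x ^ 2 := by
      have ha₆' : (M.baseChange L).a₆ ≠ 0 := by rwa [← hM]
      have h := lt_sq_of_mem (n := ℓ ^ m) hT'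
        (AddSubgroup.torsionBy (M.baseChange L).toAffine.Point ((ℓ ^ m : ℕ) : ℤ))
        (fun Q hQ ↦ by
          rw [← natCast_zsmul]
          exact (Submodule.mem_torsionBy_iff _ _).mp hQ) hodd ha₆'
        (h := hM ▸ hxy) ((Submodule.mem_torsionBy_iff _ _).mpr hPm') hx1
      rwa [← hM] at h
    have hσx : w (σ' x) = w x := hσ₁ x
    have hσx1 : w (σ' x) < 1 := hσx ▸ hx1
    -- `P^σ - P` is not small: same level, same branch
    have hns : ¬ IsSmall w (Affine.Point.some (σ' x) (σ' y) hxy' - .some x y hxy) := by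
      rcases branch hT hxy.1 hx1 hmid with ⟨hy0, -⟩ | ⟨hy1, -⟩
      · refine not_isSmall_sub_of_branch₀ hT hxy' hxy hσx hσx1 ?_ hy0
        rw [hσx, hσ₁]
        exact hy0
      · refine not_isSmall_sub_of_branch₁ hT hxy' hxy hσx hσx1 ?_ hy1
        rw [hσx, ← map_add, hσ₁]
        exact hy1
    rw [hE, isSmall_some] at hns
    exact hns hs1
  · -- `P` in the kernel of reduction: then `P^σ = P + T` would have integral `x`-coordinate
    rw [not_le] at hx
    obtain ⟨hxs, hle⟩ := val_addX_le_one_of_one_lt hxy.1 hx hs ht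
    have hsum : Affine.Point.some (σ' x) (σ' y) hxy' = .some x y hxy + .some s t hst := by
      rw [← hE, add_sub_cancel]
    rw [Affine.Point.add_of_X_ne hxs, Affine.Point.some.injEq] at hsum
    have hle' : w (σ' x) ≤ 1 := hsum.1 ▸ hle
    rw [hσ₁] at hle'
    exact absurd hle' (not_le.mpr hx)

/-! ## The Hasse invariant of a Tate form is a unit; the kernel-of-reduction count -/

/-- **`A_p ≡ 1 (mod a₄, a₆)` for `y² + xy = x³ + a₄x + a₆`** (`p` odd): reduce modulo the
ideal `(a₄, a₆)`, where the equation becomes `y² + xy = x³` with `2`-torsion polynomial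
`4x³ + x²` and `[x^{p-1}] (4x³ + x²)^{(p-1)/2} = [x⁰] (4x + 1)^{(p-1)/2} = 1`.
[Silverman AEC V.4.1(a)] [folklore] -/
theorem _root_.WeierstrassCurve.hasseCoeff_sub_one_mem_span_of_a₁_eq_one {R : Type*} [CommRing R]
    (W : WeierstrassCurve R) (h1 : W.a₁ = 1) (h2 : W.a₂ = 0) (h3 : W.a₃ = 0) {p : ℕ}
    (hp : Odd p) : W.hasseCoeff p - 1 ∈ Ideal.span {W.a₄, W.a₆} := by
  set I : Ideal R := Ideal.span {W.a₄, W.a₆}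
  rw [← Ideal.Quotient.eq_zero_iff_mem, map_sub, map_one, sub_eq_zero,
    ← WeierstrassCurve.map_hasseCoeff W (Ideal.Quotient.mk I) p]
  have h4 : Ideal.Quotient.mk I W.a₄ = 0 :=
    Ideal.Quotient.eq_zero_iff_mem.mpr (Ideal.subset_span (by simp))
  have h6 : Ideal.Quotient.mk I W.a₆ = 0 :=
    Ideal.Quotient.eq_zero_iff_mem.mpr (Ideal.subset_span (by simp))
  have hmap : W.map (Ideal.Quotient.mk I) = ⟨1, 0, 0, 0, 0⟩ := by
    ext <;> simp [WeierstrassCurve.map, h1, h2, h3, h4, h6]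
  obtain ⟨m, rfl⟩ := hp
  have hm : (2 * m + 1 - 1) / 2 = m := by omega
  have hm' : 2 * m + 1 - 1 = 2 * m := by omega
  have htors : (⟨1, 0, 0, 0, 0⟩ : WeierstrassCurve (R ⧸ I)).twoTorsionPolynomial.toPoly =
      Polynomial.X ^ 2 * (4 * Polynomial.X + 1) := by
    simp only [WeierstrassCurve.twoTorsionPolynomial, WeierstrassCurve.b₂, WeierstrassCurve.b₄,
      WeierstrassCurve.b₆, Cubic.toPoly, map_ofNat, one_pow, mul_zero, add_zero,
      zero_pow two_ne_zero, Polynomial.C_0, Polynomial.C_1]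
    ring
  rw [hmap, WeierstrassCurve.hasseCoeff, htors, hm, hm', mul_pow, ← pow_mul,
    mul_comm (Polynomial.X ^ (2 * m)), Polynomial.coeff_mul_X_pow', if_pos le_rfl, Nat.sub_self,
    Polynomial.coeff_zero_eq_eval_zero, Polynomial.eval_pow, Polynomial.eval_add,
    Polynomial.eval_mul, Polynomial.eval_ofNat, Polynomial.eval_X, mul_zero, zero_add,
    Polynomial.eval_one, one_pow]

/-- **A Tate-shaped equation over a local ring has invertible Hasse invariant**: `a₁ = 1`,
`a₂ = a₃ = 0`, `a₄, a₆ ∈ 𝔪`, `p` odd `⟹ A_p ∈ Rˣ` (multiplicative reduction: the formal group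
has height `1`, Serre 1968, IV, A.1.1). [cite: SerreAbelianLadic1968, IV A.1.1] -/
theorem _root_.WeierstrassCurve.isUnit_hasseCoeff_of_a₁_eq_one {R : Type*} [CommRing R]
    [IsLocalRing R] (W : WeierstrassCurve R) (h1 : W.a₁ = 1) (h2 : W.a₂ = 0) (h3 : W.a₃ = 0)
    (h4 : W.a₄ ∈ IsLocalRing.maximalIdeal R) (h6 : W.a₆ ∈ IsLocalRing.maximalIdeal R) {p : ℕ}
    (hp : Odd p) : IsUnit (W.hasseCoeff p) := by
  have hmem : W.hasseCoeff p - 1 ∈ IsLocalRing.maximalIdeal R := by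
    refine (Ideal.span_le.mpr ?_) (W.hasseCoeff_sub_one_mem_span_of_a₁_eq_one h1 h2 h3 hp)
    rintro a (rfl | rfl)
    · exact h4
    · simpa using h6
  by_contra hnu
  have h1' : (1 : R) ∈ IsLocalRing.maximalIdeal R := by
    have := Ideal.sub_mem _ ((IsLocalRing.mem_maximalIdeal _).mpr hnu) hmem
    rwa [sub_sub_cancel] at this
  exact (IsLocalRing.maximalIdeal.isMaximal R).ne_top ((Ideal.eq_top_iff_one _).mpr h1')

/-- **The Hasse invariant of a Tate form has valuation `1`** (`p` odd).
[cite: SerreAbelianLadic1968, IV A.1.1] -/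
theorem valuation_hasseCoeff_eq_one {F : Type*} [Field F] [Algebra F L] (W : WeierstrassCurve F)
    [hint : (W.baseChange L).IsIntegral w.integer] (hT : IsTateForm w (W.baseChange L)) {p : ℕ}
    (hp : Odd p) : w ((W.baseChange L).hasseCoeff p) = 1 := by
  obtain ⟨M, hM⟩ := hint.integral
  have hv := Valuation.integer.integers w
  have hT' : IsTateForm w (M.baseChange L) := hM ▸ hT
  have h₁ : M.a₁ = 1 := Subtype.ext (by simpa using hT'.a₁)
  have h₂ : M.a₂ = 0 := Subtype.ext (by simpa using hT'.a₂)
  have h₃ : M.a₃ = 0 := Subtype.ext (by simpa using hT'.a₃)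
  have h₄ : M.a₄ ∈ IsLocalRing.maximalIdeal w.integer := by
    rw [IsLocalRing.mem_maximalIdeal, mem_nonunits_iff, hv.isUnit_iff_valuation_eq_one]
    exact (hT'.w_a₄_le.trans_lt hT'.w_a₆_lt).ne
  have h₆ : M.a₆ ∈ IsLocalRing.maximalIdeal w.integer := by
    rw [IsLocalRing.mem_maximalIdeal, mem_nonunits_iff, hv.isUnit_iff_valuation_eq_one]
    exact hT'.w_a₆_lt.ne
  have hu := M.isUnit_hasseCoeff_of_a₁_eq_one h₁ h₂ h₃ h₄ h₆ hp
  rw [hM, show M.baseChange L = M.map (algebraMap w.integer L) from rfl,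
    WeierstrassCurve.map_hasseCoeff]
  exact (hv.isUnit_iff_valuation_eq_one).mp hu

/-- **The kernel-of-reduction count on a Tate form**: over an algebraically closed valued field
of residue characteristic `ℓ` (odd), a finite subgroup `G ⊆ E₁(L) ∪ {O}` of a Tate form killed
by `ℓᵐ` has at most `ℓᵐ` elements (`card_addSubgroup_le_pow_of_hasseCoeff` of
`KernelReductionOrdinaryTorsionProofs`, the Hasse invariant being a unit).
[cite: SerreAbelianLadic1968, IV A.1.1–A.1.2] -/
theorem card_addSubgroup_le_pow {F : Type*} [Field F] [Algebra F L] (W : WeierstrassCurve F)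
    [hint : (W.baseChange L).IsIntegral w.integer] (hT : IsTateForm w (W.baseChange L))
    {ℓ : ℕ} [hℓ : Fact ℓ.Prime] [IsAlgClosed L] (hℓ2 : ℓ ≠ 2) (hℓw : w ℓ < 1) (hℓL : (ℓ : L) ≠ 0)
    (m : ℕ) (G : AddSubgroup (W.baseChange L).toAffine.Point) [Finite G]
    (h1 : ∀ x y h, Affine.Point.some x y h ∈ G → 1 < w x)
    (hm : ∀ P ∈ G, ((ℓ ^ m : ℕ) : ℤ) • P = 0) : Nat.card G ≤ ℓ ^ m :=
  card_addSubgroup_le_pow_of_hasseCoeff w (W.baseChange L) hℓ2 hℓw hℓL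
    (valuation_hasseCoeff_eq_one W hT (hℓ.out.eq_two_or_odd'.resolve_left hℓ2)) m G h1 hm

end TateForm

end Literature.NumberTheory.EllipticCurves

end
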